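import Literature.NumberTheory.GaloisRepresentations.GlobalReciprocityModPowersUnramifiedLayers
import Literature.NumberTheory.GaloisRepresentations.GlobalReciprocityBidualityLayers
import HarnessLib

/-!
# Every compatible family of functionals on the `ℤ/m`-characters of the finite abelian layers `L ⊆ K̄` UNRAMIFIED
# OUTSIDE `S` is evaluation at `ψ_{L|K}(x)` for ONE idèle `x` — the surjectivity of Milne's `α¹(G_{K,S}, ℤ/m)` at the
# base layer of the `S`-idèle class formation (Milne ADT I Thm. 1.8 (b), §4; Harari Prop. 15.42 (a), Thm. 17.2)

Topic `NumberTheory/GaloisRepresentations`; namespace `Literature.NumberTheory.GaloisRepresentations`.  Definitions with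
bodies (the subgroup `powKilledUnramifiedCharacters K m S` of continuous characters of `Γ_K^{ab}` killed on `m`-th powers
and on `θ(Ū_K^S)`, a chosen `S`-unramified layer descent `someUnramifiedDescent`, the functional
`unramifiedDescentFunctional`) and theorems; NO named fact, no `sorry`, no instance, no notation; number fields in `Type`.
`S`-port of door-c6 g14's `GlobalReciprocityBidualityLayers.lean` (all places: `exists_idele_forall_layer_character_eq`),
companion of `GlobalReciprocityModPowersUnramifiedLayers.lean` (injectivity at the base layer).

THE POINT.  For the `P`-class formation `(G_S, C_S)` (Harari Thm. 17.2) Milne's hypothesis (b) of Tate's duality theorem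
asks that `α¹(U, ℤ/m) : C_S(L)/m → Hom(H¹(U, ℤ/m), ℚ/ℤ)` be bijective for `U = Gal(K_S/L)`.  At the base layer `L = K`,
with `H¹(G_{K,S}, ℤ/m)` read as the union of the layers `Hom(Gal(L/K), ℤ/m)` over the finite abelian `L ⊆ K̄` UNRAMIFIED
OUTSIDE `S`, a functional is a COMPATIBLE FAMILY `Φ_L : Hom(Gal(L/K), ℤ/m) → ℤ/m` on those layers (additive;
`Φ_L χ = Φ_{L'} χ'` whenever `χ ∘ res_L = χ' ∘ res_{L'}` on `Γ_K`), and SURJECTIVITY says that every such family is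
`χ ↦ χ(ψ_{L|K} x)` for one idèle `x` (Harari Prop. 15.42 (a): `C_S(K) → G_S^{ab}` has dense image with divisible kernel,
i.e. `C_S(K)/m ↠ G_S^{ab}/m`).  Proof, as door-c6 g14's with one refinement: a character `χ̄` of `Γ_K^{ab}` killed on
`m`-th powers AND on `θ(Ū_K^S)` descends to an `S`-UNRAMIFIED layer (**`LayerDescent.exists_unramified`**: any descent
`(L, χ)` refines to the fixed field of `ker χ`, which is unramified outside `S` by Lang XI §4 Thm. 4
`artinIdeleMap_lift_fixedField_eq_one_iff` + `isUnramifiedIn_iff_forall_artinIdeleMap_localUnits_eq_one`, because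
`χ(ψ_{L|K}⟨𝒪_vˣ⟩_v)/m = χ̄(θ ⟨𝒪_vˣ⟩_v) = 0` for `v ∉ S`, `localUnits_mem_unitIdelesOutside`); `Φ` of such a descent is
well defined and additive (`S`-unramified compositum, `isUnramifiedIn_sup`, `isAbelianGalois_sup`); extended to all
continuous characters by the injectivity of `ℚ/ℤ` it is evaluation at some `g = θ(x̄)` (Pontryagin,
`exists_forall_character_apply_eq`; `artinTheta_surjective`); and the character `χ(·|_L)/m` of an `S`-unramified layer
IS killed on `θ(Ū_K^S)` (`artinIdeleMap_eq_one_of_mem_unitIdelesOutside`).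

* §1 **`LayerDescent.exists_unramified`**.
* §2 `powKilledUnramifiedCharacters`, `someUnramifiedDescent` (+ `_unramified`), `unramifiedDescentValue`
  (+ `_eq_of_layerDescent`, `_add`), `unramifiedDescentFunctional` (+ `_apply_eq_of_layerDescent`).
* §3 **`exists_idele_forall_unramified_layer_character_eq`** — surjectivity of `α¹(G_{K,S}, ℤ/m)` at the base layer,
  and its Bockstein form **`exists_idele_forall_unramified_layer_pairing_eq`**
  (`Φ_L χ / m = −inv_{L/K}(ι[x] ∪ β_m[χ])`, door-c6 g14's dictionary).

HONEST FRAMING: classical (Pontryagin duality + global class field theory) in the tree's currency; no case of BSD /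
Poitou–Tate.  Written for the background lane «PT-Ш-S-TC» of cell bsd-eis (crux `GoodLatticeBDPValue`,
stmt-BirchSwinnertonDyer-19032): the arithmetic core of the surjectivity half of the field `adjointBijective_one_zmod_pow`
of `DiscreteRep.TateDualityHypothesesAt p` for `(G_S, C̄_S)`, to be consumed through door-c4 g16's
`DiscreteRep.adjointSurjective_triv_zmod_of_cofinal`.

## References
* J. S. Milne, *Arithmetic Duality Theorems*, 2nd ed. (2006), Ch. I Thm. 1.8 (b), §4 (the class formation `(G_S, C_S)`).
  [MilneADT2006]
* D. Harari, *Galois Cohomology and Class Field Theory*, Universitext (2020), Prop. 15.42 (a), Thm. 17.2. [Harari2020]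
* S. Lang, *Algebraic Number Theory*, 2nd ed., GTM 110 (1994), Ch. XI §4 Theorem 4. [LangANT1994]
* J. Neukirch, *Class Field Theory — The Bonn Lectures* (2013), Part III Thm. (7.12), §6 (6.13)–(6.14). [Neukirch2013]
* J.-P. Serre, *Local Fields*, GTM 67 (1979), XIII §1 (Pontryagin duality for profinite abelian groups). [SerreLocalFields1979]
-/

noncomputable section

open scoped NumberField
open NumberField IsDedekindDomain Field Function

namespace Literature.NumberTheory.GaloisRepresentations

open _root_.TopRep _root_.ContRepresentation _root_.ContinuousCohomology
open Literature.AnabelianGeometry.AbsoluteAnabelian.Prop121vii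
open Literature.NumberTheory.NumberFields

variable {K : Type} [Field K] [NumberField K]

/-! ## §1. A descent killed on `θ(Ū_K^S)` refines to an `S`-unramified layer -/

section Unramified

variable {m : ℕ} [NeZero m]

omit [NumberField K] in
/-- `L^H ⊆ K̄` is finite over `K` (auxiliary; `H ≤ Gal(L/K)`). [folklore] -/
private theorem finiteDimensional_lift_fixedField'' (L : IntermediateField K (AlgebraicClosure K))
    [FiniteDimensional K L] (H : Subgroup (L ≃ₐ[K] L)) :
    FiniteDimensional K (IntermediateField.lift (IntermediateField.fixedField H) :
      IntermediateField K (AlgebraicClosure K)) :=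
  LinearEquiv.finiteDimensional (IntermediateField.liftAlgEquiv (IntermediateField.fixedField H)).toLinearEquiv

omit [NumberField K] in
/-- `L^H ⊆ K̄` is abelian over `K` when `L` is (auxiliary). [folklore] -/
private theorem isAbelianGalois_lift_fixedField'' (L : IntermediateField K (AlgebraicClosure K)) [IsAbelianGalois K L]
    (H : Subgroup (L ≃ₐ[K] L)) :
    IsAbelianGalois K (IntermediateField.lift (IntermediateField.fixedField H) :
      IntermediateField K (AlgebraicClosure K)) :=
  IsAbelianGalois.of_algHom (IntermediateField.inclusion (IntermediateField.lift_le _))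

/-- **A layer descent of a character `χ̄` of `Γ_K^{ab}` that kills `θ(Ū_K^S)` refines to an `S`-UNRAMIFIED layer
descent.**  Given a descent `(L, χ)` of `χ̄` (`χ(ψ̄_{L|K} c)/m = χ̄(θ c)`), let `L' := L^{ker χ} ⊆ L`; the character
`χ` factors through `Gal(L'/K)` (as `c ↦ χ(ψ̄_{L|K} c)` factors through `ψ̄_{L'|K}`, whose kernel is `ψ̄_{L|K}⁻¹(ker χ)`,
`artinIdeleMap_lift_fixedField_eq_one_iff`), giving a descent `(L', χ')`; and `L'` is unramified at every `v ∉ S`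
(Lang XI §4 Thm. 4, `isUnramifiedIn_iff_forall_artinIdeleMap_localUnits_eq_one`): for a local unit `u ∈ 𝒪_vˣ`,
`χ(ψ_{L|K}⟨u⟩_v)/m = χ̄(θ ⟨u⟩_v) = 0` since `⟨u⟩_v ∈ U_K^S`.
[cite: LangANT1994, Ch. XI §4 Thm. 4] [cite: Neukirch2013, Part III §6 (6.13), (6.14)] -/
theorem LayerDescent.exists_unramified
    {χbar : contOneCocycles (ContinuousRep.trivial (absoluteGaloisGroupAbelianization K) ℤ QModZCoeff.{0}).toTopRep}
    (d : LayerDescent m χbar) (S : Finset (HeightOneSpectrum (𝓞 K)))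
    (hU : ∀ u ∈ unitIdelesOutside K S,
      χbar.1 ((isCompatibleSystem_artinMapFamily (K := K) artinReciprocity_character_holds).theta
        (QuotientGroup.mk u)) = 0) :
    ∃ d' : LayerDescent m χbar, ∀ v : HeightOneSpectrum (𝓞 K), v ∉ S → Algebra.IsUnramifiedIn (𝓞 d'.L) v.asIdeal := by
  classical
  haveI := d.fd
  haveI := d.ab
  haveI : NumberField d.L := NumberField.of_module_finite K d.L
  -- `χ` as a multiplicative character of `Gal(L/K)`, its kernel `H`, and the fixed field `L' = L^H`
  let g : (d.L ≃ₐ[K] d.L) →* Multiplicative (ZMod m) := AddMonoidHom.toMultiplicativeRight d.χ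
  have hg : ∀ σ, g σ = Multiplicative.ofAdd (d.χ (Additive.ofMul σ)) := fun σ => rfl
  haveI hL'fd : FiniteDimensional K (IntermediateField.lift (IntermediateField.fixedField g.ker) :
      IntermediateField K (AlgebraicClosure K)) := finiteDimensional_lift_fixedField'' d.L g.ker
  haveI hL'ab : IsAbelianGalois K (IntermediateField.lift (IntermediateField.fixedField g.ker) :
      IntermediateField K (AlgebraicClosure K)) := isAbelianGalois_lift_fixedField'' d.L g.ker
  haveI : NumberField (IntermediateField.lift (IntermediateField.fixedField g.ker) :
      IntermediateField K (AlgebraicClosure K)) := NumberField.of_module_finite K _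
  -- `f c := χ(ψ̄_{L|K} c)` factors through `ψ̄_{L'|K}`
  let f : (ideleGroup K ⧸ principalIdeles K) →* Multiplicative (ZMod m) :=
    g.comp (artinMapFamily K artinReciprocity_character_holds d.L)
  have hf : ∀ c, f c = Multiplicative.ofAdd (d.χ (Additive.ofMul
      (artinMapFamily K artinReciprocity_character_holds d.L c))) := fun c => rfl
  have hsurj' : Surjective (artinMapFamily K artinReciprocity_character_holds
      (IntermediateField.lift (IntermediateField.fixedField g.ker) : IntermediateField K (AlgebraicClosure K))) :=
    artinMapFamily_surjective artinReciprocity_character_holds _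
  have hker' : (artinMapFamily K artinReciprocity_character_holds
      (IntermediateField.lift (IntermediateField.fixedField g.ker) : IntermediateField K (AlgebraicClosure K))).ker ≤
        f.ker := by
    intro c hc
    induction c using QuotientGroup.induction_on with
    | H y =>
      rw [MonoidHom.mem_ker, artinMapFamily_eq artinReciprocity_character_holds _, artinClassMap_mk,
        artinIdeleMap_lift_fixedField_eq_one_iff d.L g.ker y] at hc
      rw [MonoidHom.mem_ker, MonoidHom.comp_apply, artinMapFamily_eq artinReciprocity_character_holds d.L,
        artinClassMap_mk]
      exact hc
  let g' : ((IntermediateField.lift (IntermediateField.fixedField g.ker) : IntermediateField K (AlgebraicClosure K)) ≃ₐ[K]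
      (IntermediateField.lift (IntermediateField.fixedField g.ker) : IntermediateField K (AlgebraicClosure K))) →*
        Multiplicative (ZMod m) :=
    (artinMapFamily K artinReciprocity_character_holds _).liftOfSurjective hsurj' ⟨f, hker'⟩
  have hg' : ∀ c, g' (artinMapFamily K artinReciprocity_character_holds _ c) = f c := fun c =>
    (artinMapFamily K artinReciprocity_character_holds _).liftOfRightInverse_comp_apply _ _ ⟨f, hker'⟩ c
  refine ⟨⟨IntermediateField.lift (IntermediateField.fixedField g.ker), hL'fd, hL'ab, MonoidHom.toAdditiveLeft g',
    fun c => ?_⟩, fun v hv => ?_⟩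
  · -- `χ'(ψ̄_{L'|K} c)/m = χ(ψ̄_{L|K} c)/m = χ̄(θ c)`
    change zmodToQmodZ m (Multiplicative.toAdd (g' (artinMapFamily K artinReciprocity_character_holds _ c))) = _
    rw [hg', hf, toAdd_ofAdd]
    exact d.spec c
  · -- `L'` is unramified at `v ∉ S`
    refine (isUnramifiedIn_iff_forall_artinIdeleMap_localUnits_eq_one _).mpr fun u hu => ?_
    rw [artinIdeleMap_lift_fixedField_eq_one_iff d.L g.ker, MonoidHom.mem_ker, hg]
    have h := d.spec (QuotientGroup.mk (localUnits v u))
    rw [hU _ (localUnits_mem_unitIdelesOutside hv u hu), artinMapFamily_eq artinReciprocity_character_holds d.L,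
      artinClassMap_mk] at h
    have h0 : d.χ (Additive.ofMul (artinIdeleMap d.L artinReciprocity_character_holds (localUnits v u))) = 0 :=
      zmodToQmodZ_injective m (by rw [h, map_zero]; rfl)
    rw [h0]
    rfl

end Unramified

/-! ## §2. The functional on the characters killed by `m` and on `θ(Ū_K^S)`, through chosen `S`-unramified descents -/

section Functional

variable (K) (m : ℕ) [NeZero m] (S : Finset (HeightOneSpectrum (𝓞 K)))

/-- The continuous characters of `Γ_K^{ab}` killed on `m`-th powers and on `θ(Ū_K^S)` (`= Hom_cont(G_{K,S}^{ab}, ℤ/m)`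
inside `Hom_cont(Γ_K^{ab}, ℚ/ℤ)`: the closed subgroup generated by `θ(Ū_K^S)` is the one generated by the inertia groups
above the places outside `S`, Lang XI §4 Thm. 4). [cite: SerreLocalFields1979, XIII §1] [cite: LangANT1994, Ch. XI §4 Thm. 4] -/
def powKilledUnramifiedCharacters :
    AddSubgroup (contOneCocycles (ContinuousRep.trivial (absoluteGaloisGroupAbelianization K) ℤ QModZCoeff.{0}).toTopRep) where
  carrier := {χbar | (∀ g : absoluteGaloisGroupAbelianization K, χbar.1 (g ^ m) = 0) ∧
    ∀ u ∈ unitIdelesOutside K S,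
      χbar.1 ((isCompatibleSystem_artinMapFamily (K := K) artinReciprocity_character_holds).theta
        (QuotientGroup.mk u)) = 0}
  zero_mem' := ⟨fun _ => rfl, fun _ _ => rfl⟩
  add_mem' := fun {a b} ha hb => ⟨fun g => by
      change a.1 (g ^ m) + b.1 (g ^ m) = 0
      rw [ha.1 g, hb.1 g, add_zero], fun u hu => by
      change a.1 _ + b.1 _ = 0
      rw [ha.2 u hu, hb.2 u hu, add_zero]⟩
  neg_mem' := fun {a} ha => ⟨fun g => by
      change -(a.1 (g ^ m)) = 0
      rw [ha.1 g, neg_zero], fun u hu => by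
      change -(a.1 _) = 0
      rw [ha.2 u hu, neg_zero]⟩

variable {K m S}

omit [NeZero m] in
/-- Membership in `powKilledUnramifiedCharacters`. [cite: SerreLocalFields1979, XIII §1] -/
theorem mem_powKilledUnramifiedCharacters_iff
    (χbar : contOneCocycles (ContinuousRep.trivial (absoluteGaloisGroupAbelianization K) ℤ QModZCoeff.{0}).toTopRep) :
    χbar ∈ powKilledUnramifiedCharacters K m S ↔
      (∀ g : absoluteGaloisGroupAbelianization K, χbar.1 (g ^ m) = 0) ∧
        ∀ u ∈ unitIdelesOutside K S,
          χbar.1 ((isCompatibleSystem_artinMapFamily (K := K) artinReciprocity_character_holds).theta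
            (QuotientGroup.mk u)) = 0 := Iff.rfl

/-- An `S`-unramified layer descent exists for every character killed on `m`-th powers and on `θ(Ū_K^S)`.
[cite: Neukirch2013, Part III Thm. (7.12)] [cite: LangANT1994, Ch. XI §4 Thm. 4] -/
theorem exists_unramified_layerDescent (a : powKilledUnramifiedCharacters K m S) :
    ∃ d : LayerDescent m (a : contOneCocycles (ContinuousRep.trivial (absoluteGaloisGroupAbelianization K) ℤ
        QModZCoeff.{0}).toTopRep),
      ∀ v : HeightOneSpectrum (𝓞 K), v ∉ S → Algebra.IsUnramifiedIn (𝓞 d.L) v.asIdeal :=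
  (Classical.choice (exists_layerDescent m _ a.2.1)).exists_unramified S a.2.2

/-- A chosen `S`-unramified layer descent of a character killed on `m`-th powers and on `θ(Ū_K^S)`.
[cite: Neukirch2013, Part III Thm. (7.12)] -/
def someUnramifiedDescent (a : powKilledUnramifiedCharacters K m S) :
    LayerDescent m (a : contOneCocycles (ContinuousRep.trivial (absoluteGaloisGroupAbelianization K) ℤ
      QModZCoeff.{0}).toTopRep) :=
  Classical.choose (exists_unramified_layerDescent a)

/-- The chosen descent is unramified outside `S`. [cite: LangANT1994, Ch. XI §4 Thm. 4] -/
theorem someUnramifiedDescent_unramified (a : powKilledUnramifiedCharacters K m S)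
    {v : HeightOneSpectrum (𝓞 K)} (hv : v ∉ S) :
    Algebra.IsUnramifiedIn (𝓞 (someUnramifiedDescent a).L) v.asIdeal :=
  Classical.choose_spec (exists_unramified_layerDescent a) v hv

variable (Φ : (L : IntermediateField K (AlgebraicClosure K)) → (Additive (L ≃ₐ[K] L) →+ ZMod m) → ZMod m)

/-- The value of the family `Φ` on the chosen `S`-unramified descent of a character. [cite: MilneADT2006, Ch. I Thm. 1.8 (b)] -/
def unramifiedDescentValue (a : powKilledUnramifiedCharacters K m S) : ZMod m :=
  Φ (someUnramifiedDescent a).L (someUnramifiedDescent a).χ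

variable (hcompat : ∀ (L L' : IntermediateField K (AlgebraicClosure K)) [FiniteDimensional K L] [IsAbelianGalois K L]
      [FiniteDimensional K L'] [IsAbelianGalois K L'],
      (∀ v : HeightOneSpectrum (𝓞 K), v ∉ S → Algebra.IsUnramifiedIn (𝓞 L) v.asIdeal) →
      (∀ v : HeightOneSpectrum (𝓞 K), v ∉ S → Algebra.IsUnramifiedIn (𝓞 L') v.asIdeal) →
      ∀ (χ : Additive (L ≃ₐ[K] L) →+ ZMod m) (χ' : Additive (L' ≃ₐ[K] L') →+ ZMod m),
      (∀ γ : absoluteGaloisGroup K,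
        χ (Additive.ofMul (absRestrictNormalHom L γ)) = χ' (Additive.ofMul (absRestrictNormalHom L' γ))) →
      Φ L χ = Φ L' χ')

include hcompat in
/-- **`Φ` takes the same value on any two `S`-unramified descents of the same character** (compatibility read on `Γ_K`).
[cite: MilneADT2006, Ch. I Thm. 1.8 (b)] -/
theorem unramifiedDescentValue_eq_of_layerDescent (a : powKilledUnramifiedCharacters K m S)
    (d : LayerDescent m (a : contOneCocycles (ContinuousRep.trivial (absoluteGaloisGroupAbelianization K) ℤ
      QModZCoeff.{0}).toTopRep))
    (hd : ∀ v : HeightOneSpectrum (𝓞 K), v ∉ S → Algebra.IsUnramifiedIn (𝓞 d.L) v.asIdeal) :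
    unramifiedDescentValue Φ a = Φ d.L d.χ := by
  haveI := (someUnramifiedDescent a).fd; haveI := (someUnramifiedDescent a).ab; haveI := d.fd; haveI := d.ab
  refine hcompat (someUnramifiedDescent a).L d.L (fun v hv => someUnramifiedDescent_unramified a hv) hd
    (someUnramifiedDescent a).χ d.χ fun γ => zmodToQmodZ_injective m ?_
  exact ((someUnramifiedDescent a).apply_absRestrictNormalHom γ).trans (d.apply_absRestrictNormalHom γ).symm

variable (hadd : ∀ (L : IntermediateField K (AlgebraicClosure K)) [FiniteDimensional K L] [IsAbelianGalois K L],
      (∀ v : HeightOneSpectrum (𝓞 K), v ∉ S → Algebra.IsUnramifiedIn (𝓞 L) v.asIdeal) →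
      ∀ (χ χ' : Additive (L ≃ₐ[K] L) →+ ZMod m), Φ L (χ + χ') = Φ L χ + Φ L χ')

omit [NumberField K] [NeZero m] in
include hadd in
/-- `Φ L 0 = 0` on an `S`-unramified layer. [cite: MilneADT2006, Ch. I Thm. 1.8 (b)] -/
theorem apply_zero_eq_zero_of_unramified (L : IntermediateField K (AlgebraicClosure K)) [FiniteDimensional K L]
    [IsAbelianGalois K L] (hL : ∀ v : HeightOneSpectrum (𝓞 K), v ∉ S → Algebra.IsUnramifiedIn (𝓞 L) v.asIdeal) :
    Φ L (0 : Additive (L ≃ₐ[K] L) →+ ZMod m) = 0 := by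
  have h := hadd L hL 0 0
  rw [add_zero] at h
  exact left_eq_add.1 h

include hadd hcompat in
/-- **The descent value is additive**: move both descents and the descent of the sum to the compositum `L_a ⊔ L_b`
(finite abelian and unramified outside `S`: `isAbelianGalois_sup`, `isUnramifiedIn_sup`) along
`exists_comp_absRestrictNormalHom_eq`, where `Φ` is additive.
[cite: MilneADT2006, Ch. I Thm. 1.8 (b)] [cite: NeukirchANT1999, Ch. II (7.2)] -/
theorem unramifiedDescentValue_add (a b : powKilledUnramifiedCharacters K m S) :
    unramifiedDescentValue Φ (a + b) = unramifiedDescentValue Φ a + unramifiedDescentValue Φ b := by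
  let da := someUnramifiedDescent a
  let db := someUnramifiedDescent b
  let dab := someUnramifiedDescent (a + b)
  haveI := da.fd; haveI := da.ab; haveI := db.fd; haveI := db.ab; haveI := dab.fd; haveI := dab.ab
  have hda : ∀ v : HeightOneSpectrum (𝓞 K), v ∉ S → Algebra.IsUnramifiedIn (𝓞 da.L) v.asIdeal :=
    fun v hv => someUnramifiedDescent_unramified a hv
  have hdb : ∀ v : HeightOneSpectrum (𝓞 K), v ∉ S → Algebra.IsUnramifiedIn (𝓞 db.L) v.asIdeal :=
    fun v hv => someUnramifiedDescent_unramified b hv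
  have hdab : ∀ v : HeightOneSpectrum (𝓞 K), v ∉ S → Algebra.IsUnramifiedIn (𝓞 dab.L) v.asIdeal :=
    fun v hv => someUnramifiedDescent_unramified (a + b) hv
  let L' : IntermediateField K (AlgebraicClosure K) := da.L ⊔ db.L
  haveI : FiniteDimensional K L' := IntermediateField.finiteDimensional_sup da.L db.L
  haveI : IsAbelianGalois K L' := isAbelianGalois_sup da.L db.L
  have hL' : ∀ v : HeightOneSpectrum (𝓞 K), v ∉ S → Algebra.IsUnramifiedIn (𝓞 L') v.asIdeal :=
    fun v hv => isUnramifiedIn_sup (hda v hv) (hdb v hv)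
  obtain ⟨πa, hπa⟩ := exists_comp_absRestrictNormalHom_eq da.L (le_sup_left : da.L ≤ L')
  obtain ⟨πb, hπb⟩ := exists_comp_absRestrictNormalHom_eq db.L (le_sup_right : db.L ≤ L')
  let χa' : Additive (L' ≃ₐ[K] L') →+ ZMod m := da.χ.comp (MonoidHom.toAdditive πa)
  let χb' : Additive (L' ≃ₐ[K] L') →+ ZMod m := db.χ.comp (MonoidHom.toAdditive πb)
  have ha : Φ da.L da.χ = Φ L' χa' := hcompat _ _ hda hL' _ _ fun γ =>
    congrArg (fun t => da.χ (Additive.ofMul t)) (hπa γ).symm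
  have hb : Φ db.L db.χ = Φ L' χb' := hcompat _ _ hdb hL' _ _ fun γ =>
    congrArg (fun t => db.χ (Additive.ofMul t)) (hπb γ).symm
  have hab : Φ dab.L dab.χ = Φ L' (χa' + χb') := hcompat _ _ hdab hL' _ _ fun γ => by
    apply zmodToQmodZ_injective m
    have e1 := dab.apply_absRestrictNormalHom γ
    have e2 := da.apply_absRestrictNormalHom γ
    have e3 := db.apply_absRestrictNormalHom γ
    have e4 : zmodToQmodZ m ((χa' + χb') (Additive.ofMul (absRestrictNormalHom L' γ))) =
        zmodToQmodZ m (da.χ (Additive.ofMul (absRestrictNormalHom da.L γ))) +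
          zmodToQmodZ m (db.χ (Additive.ofMul (absRestrictNormalHom db.L γ))) := by
      exact (map_add (zmodToQmodZ m) _ _).trans
        (congrArg₂ (· + ·) (congrArg (fun t => zmodToQmodZ m (da.χ (Additive.ofMul t))) (hπa γ))
          (congrArg (fun t => zmodToQmodZ m (db.χ (Additive.ofMul t))) (hπb γ)))
    have e5 : (((a + b : powKilledUnramifiedCharacters K m S) :
          contOneCocycles (ContinuousRep.trivial (absoluteGaloisGroupAbelianization K) ℤ QModZCoeff.{0}).toTopRep).1
          (absGaloisAbProj K γ)).down =
        ((a : contOneCocycles (ContinuousRep.trivial (absoluteGaloisGroupAbelianization K) ℤ QModZCoeff.{0}).toTopRep).1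
            (absGaloisAbProj K γ)).down +
          ((b : contOneCocycles (ContinuousRep.trivial (absoluteGaloisGroupAbelianization K) ℤ QModZCoeff.{0}).toTopRep).1
            (absGaloisAbProj K γ)).down := rfl
    exact e1.trans (e5.trans ((congrArg₂ (· + ·) e2.symm e3.symm).trans e4.symm))
  change Φ dab.L dab.χ = Φ da.L da.χ + Φ db.L db.χ
  exact hab.trans ((hadd L' hL' χa' χb').trans (congrArg₂ (· + ·) ha.symm hb.symm))

/-- **The functional `χ̄ ↦ Φ(S-unramified descent of χ̄)` on the characters of `Γ_K^{ab}` killed on `m`-th powers and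
on `θ(Ū_K^S)`.** [cite: MilneADT2006, Ch. I Thm. 1.8 (b)] -/
def unramifiedDescentFunctional : powKilledUnramifiedCharacters K m S →+ ZMod m where
  toFun := unramifiedDescentValue Φ
  map_zero' := by
    haveI := (someUnramifiedDescent (0 : powKilledUnramifiedCharacters K m S)).fd
    haveI := (someUnramifiedDescent (0 : powKilledUnramifiedCharacters K m S)).ab
    have hL0 : ∀ v : HeightOneSpectrum (𝓞 K), v ∉ S →
        Algebra.IsUnramifiedIn (𝓞 (someUnramifiedDescent (0 : powKilledUnramifiedCharacters K m S)).L) v.asIdeal :=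
      fun v hv => someUnramifiedDescent_unramified _ hv
    have h0 : unramifiedDescentValue Φ (0 : powKilledUnramifiedCharacters K m S) =
        Φ (someUnramifiedDescent (0 : powKilledUnramifiedCharacters K m S)).L 0 := by
      refine hcompat _ _ hL0 hL0 _ _ fun γ => zmodToQmodZ_injective m ?_
      exact ((someUnramifiedDescent (0 : powKilledUnramifiedCharacters K m S)).apply_absRestrictNormalHom γ).trans
        (map_zero (zmodToQmodZ m)).symm
    exact h0.trans (apply_zero_eq_zero_of_unramified Φ hadd _ hL0)
  map_add' := unramifiedDescentValue_add Φ hcompat hadd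

/-- Unfolding: `unramifiedDescentFunctional a = Φ` of ANY `S`-unramified descent of `a`.
[cite: MilneADT2006, Ch. I Thm. 1.8 (b)] -/
theorem unramifiedDescentFunctional_apply_eq_of_layerDescent (a : powKilledUnramifiedCharacters K m S)
    (d : LayerDescent m (a : contOneCocycles (ContinuousRep.trivial (absoluteGaloisGroupAbelianization K) ℤ
      QModZCoeff.{0}).toTopRep))
    (hd : ∀ v : HeightOneSpectrum (𝓞 K), v ∉ S → Algebra.IsUnramifiedIn (𝓞 d.L) v.asIdeal) :
    unramifiedDescentFunctional Φ hcompat hadd a = Φ d.L d.χ :=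
  unramifiedDescentValue_eq_of_layerDescent Φ hcompat a d hd

end Functional

/-! ## §3. Surjectivity of `α¹(G_{K,S}, ℤ/m)` at the base layer -/

section Surjectivity

/-- **The character `χ(·|_L)/m` of an `S`-unramified layer kills `θ(Ū_K^S)`**: `χ̄(θ ū) = χ(ψ_{L|K} u)/m = 0` for
`u ∈ U_K^S` (`artinIdeleMap_eq_one_of_mem_unitIdelesOutside`). [cite: LangANT1994, Ch. XI §4 Thm. 4] -/
theorem layerCharacter_artinTheta_mk_eq_zero_of_mem_unitIdelesOutside (m : ℕ) [NeZero m]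
    (L : IntermediateField K (AlgebraicClosure K)) [FiniteDimensional K L] [IsAbelianGalois K L]
    {S : Finset (HeightOneSpectrum (𝓞 K))}
    (hL : ∀ v : HeightOneSpectrum (𝓞 K), v ∉ S → Algebra.IsUnramifiedIn (𝓞 L) v.asIdeal)
    (χ : Additive (L ≃ₐ[K] L) →+ ZMod m) {u : ideleGroup K} (hu : u ∈ unitIdelesOutside K S) :
    (layerCharacter m L χ).1 ((isCompatibleSystem_artinMapFamily (K := K) artinReciprocity_character_holds).theta
      (QuotientGroup.mk u)) = 0 := by
  haveI : NumberField L := NumberField.of_module_finite K L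
  have h := (layerDescentSelf m L χ).spec (QuotientGroup.mk u)
  change zmodToQmodZ m (χ (Additive.ofMul (artinMapFamily K artinReciprocity_character_holds L (QuotientGroup.mk u)))) = _
    at h
  rw [artinMapFamily_eq artinReciprocity_character_holds L, artinClassMap_mk,
    artinIdeleMap_eq_one_of_mem_unitIdelesOutside L hL hu, ofMul_one, map_zero, map_zero] at h
  exact ULift.ext _ _ h.symm

/-- **Every compatible additive family of functionals on the `ℤ/m`-characters of the finite abelian layers UNRAMIFIED
OUTSIDE `S` is evaluation at `ψ_{L|K}(x)` for one idèle `x`.**  Let `m ≥ 1` and let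
`Φ_L : Hom(Gal(L/K), ℤ/m) → ℤ/m` (`L ⊆ K̄` finite abelian, unramified at every `v ∉ S`) be additive in `χ` and compatible:
`Φ_L χ = Φ_{L'} χ'` whenever `χ(γ|_L) = χ'(γ|_{L'})` for all `γ ∈ Γ_K`.  Then there is an idèle `x` of `K` with
`Φ_L χ = χ(ψ_{L|K} x)` for every such `L` and `χ` — the surjectivity of Milne's
`α¹(G_{K,S}, ℤ/m) : C_S(K)/m → H¹(G_{K,S}, ℤ/m)^*` for the `S`-idèle class formation at the base layer, with
`H¹(G_{K,S}, ℤ/m) = ⋃_L Hom(Gal(L/K), ℤ/m)` over the `S`-unramified abelian layers (Harari Prop. 15.42 (a):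
`C_S(K) ↠ G_S^{ab}` modulo the divisible `D_S(K)`).
[cite: MilneADT2006, Ch. I Thm. 1.8 (b)] [cite: Harari2020, Prop. 15.42 (a), Thm. 17.2] [cite: SerreLocalFields1979, XIII §1]
[cite: Neukirch2013, Part III Thm. (7.12)] -/
theorem exists_idele_forall_unramified_layer_character_eq {m : ℕ} (hm : 0 < m)
    (S : Finset (HeightOneSpectrum (𝓞 K)))
    (Φ : (L : IntermediateField K (AlgebraicClosure K)) → (Additive (L ≃ₐ[K] L) →+ ZMod m) → ZMod m)
    (hadd : ∀ (L : IntermediateField K (AlgebraicClosure K)) [FiniteDimensional K L] [IsAbelianGalois K L],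
      (∀ v : HeightOneSpectrum (𝓞 K), v ∉ S → Algebra.IsUnramifiedIn (𝓞 L) v.asIdeal) →
      ∀ (χ χ' : Additive (L ≃ₐ[K] L) →+ ZMod m), Φ L (χ + χ') = Φ L χ + Φ L χ')
    (hcompat : ∀ (L L' : IntermediateField K (AlgebraicClosure K)) [FiniteDimensional K L] [IsAbelianGalois K L]
      [FiniteDimensional K L'] [IsAbelianGalois K L'],
      (∀ v : HeightOneSpectrum (𝓞 K), v ∉ S → Algebra.IsUnramifiedIn (𝓞 L) v.asIdeal) →
      (∀ v : HeightOneSpectrum (𝓞 K), v ∉ S → Algebra.IsUnramifiedIn (𝓞 L') v.asIdeal) →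
      ∀ (χ : Additive (L ≃ₐ[K] L) →+ ZMod m) (χ' : Additive (L' ≃ₐ[K] L') →+ ZMod m),
      (∀ γ : absoluteGaloisGroup K,
        χ (Additive.ofMul (absRestrictNormalHom L γ)) = χ' (Additive.ofMul (absRestrictNormalHom L' γ))) →
      Φ L χ = Φ L' χ') :
    ∃ x : ideleGroup K, ∀ (L : IntermediateField K (AlgebraicClosure K)) (_ : FiniteDimensional K L)
      (_ : IsAbelianGalois K L),
      (∀ v : HeightOneSpectrum (𝓞 K), v ∉ S → Algebra.IsUnramifiedIn (𝓞 L) v.asIdeal) →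
      ∀ χ : Additive (L ≃ₐ[K] L) →+ ZMod m,
      haveI : NumberField L := NumberField.of_module_finite K L
      Φ L χ = χ (Additive.ofMul (artinIdeleMap L artinReciprocity_character_holds x)) := by
  classical
  haveI : NeZero m := ⟨hm.ne'⟩
  haveI : CompactSpace (absoluteGaloisGroup K) := absoluteGaloisGroup_compactSpace K
  -- extend `unramifiedDescentFunctional/m : X → ℚ/ℤ` to all continuous characters of `Γ_K^{ab}` (injectivity of `ℚ/ℤ`)
  let X := powKilledUnramifiedCharacters K m S
  let ψ₀ : X →+ ZMod m := unramifiedDescentFunctional Φ hcompat hadd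
  let ψ₀' : CharacterModule X := (zmodToQmodZ m).comp ψ₀
  obtain ⟨ψ₁, hψ₁⟩ := CharacterModule.dual_surjective_of_injective (X.subtype.toIntLinearMap)
    (fun a b h => Subtype.ext h) ψ₀'
  have hψ₁' : ∀ a : X,
      ψ₁ (a : contOneCocycles (ContinuousRep.trivial (absoluteGaloisGroupAbelianization K) ℤ QModZCoeff.{0}).toTopRep) =
        zmodToQmodZ m (ψ₀ a) := fun a =>
    congrArg (fun c : CharacterModule X => c a) hψ₁
  let ψ : contOneCocycles (ContinuousRep.trivial (absoluteGaloisGroupAbelianization K) ℤ QModZCoeff.{0}).toTopRep →+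
      QModZCoeff.{0} :=
    { toFun := fun χbar => ULift.up (ψ₁ χbar)
      map_zero' := by rw [map_zero]; rfl
      map_add' := fun a b => by rw [map_add]; rfl }
  -- Pontryagin: `ψ` is evaluation at a point `g = θ(x̄)`
  obtain ⟨g, hg⟩ := exists_forall_character_apply_eq ψ
  obtain ⟨c₀, hc₀⟩ := artinTheta_surjective K g
  obtain ⟨x, rfl⟩ := QuotientGroup.mk_surjective c₀
  refine ⟨x, fun L hL hab hunr χ => ?_⟩
  haveI := hL
  haveI := hab
  haveI : NumberField L := NumberField.of_module_finite K L
  -- the character of `Γ_K^{ab}` attached to `(L, χ)` lies in `X` and is descended by `(L, χ)` itself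
  let a : X := ⟨layerCharacter m L χ, layerCharacter_pow_eq_zero m L χ,
    fun u hu => layerCharacter_artinTheta_mk_eq_zero_of_mem_unitIdelesOutside m L hunr χ hu⟩
  have h1 : ψ₀ a = Φ L χ :=
    unramifiedDescentFunctional_apply_eq_of_layerDescent Φ hcompat hadd a (layerDescentSelf m L χ) hunr
  -- evaluate `ψ` at `a` in two ways
  have h2 : (ψ (a : contOneCocycles _)).down = zmodToQmodZ m (Φ L χ) := by
    change ψ₁ (a : contOneCocycles _) = _
    rw [hψ₁' a, h1]
  have h3 : (ψ (a : contOneCocycles _)).down =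
      zmodToQmodZ m (χ (Additive.ofMul (artinIdeleMap L artinReciprocity_character_holds x))) := by
    rw [hg, ← hc₀]
    change ((layerCharacter m L χ).1
      ((isCompatibleSystem_artinMapFamily (K := K) artinReciprocity_character_holds).theta (QuotientGroup.mk x))).down = _
    rw [← (layerDescentSelf m L χ).spec (QuotientGroup.mk x)]
    change zmodToQmodZ m (χ (Additive.ofMul (artinMapFamily K artinReciprocity_character_holds L (QuotientGroup.mk x)))) = _
    rw [artinMapFamily_eq artinReciprocity_character_holds L, artinClassMap_mk]
  exact zmodToQmodZ_injective m (h2.symm.trans h3)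

open CategoryTheory groupCohomology Literature.Algebra.Homology Literature.Algebra.Homology.Bockstein
  Literature.NumberTheory.Automorphic Literature.NumberTheory.Automorphic.IdeleClassGroup IdeleCohomology in
/-- **Bockstein form** (the layer pairing of Milne's `α¹` for `(G_{K,S}, C_S)`, surjectivity): every additive family
`Φ_L : Hom(Gal(L/K), ℤ/m) → ℤ/m` over the finite abelian `L ⊆ K̄` unramified outside `S`, compatible on `Γ_K`, is
`Φ_L χ / m = −inv_{L/K}(ι[x] ∪ β_m[χ])` in `ℚ/ℤ` for ONE idèle `x` (door-c6 g14's dictionary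
`inv_{L/K}(ι[x] ∪ β_m[χ]) = −χ(ψ_{L|K} x)/m`).
[cite: MilneADT2006, Ch. I Thm. 1.8 (b), §4] [cite: Harari2020, Prop. 15.42 (a), Thm. 17.2]
[cite: CasselsFrohlichANT1967, Ch. VII §11.3] -/
theorem exists_idele_forall_unramified_layer_pairing_eq {m : ℕ} (hm : 0 < m)
    (S : Finset (HeightOneSpectrum (𝓞 K)))
    (Φ : (L : IntermediateField K (AlgebraicClosure K)) → (Additive (L ≃ₐ[K] L) →+ ZMod m) → ZMod m)
    (hadd : ∀ (L : IntermediateField K (AlgebraicClosure K)) [FiniteDimensional K L] [IsAbelianGalois K L],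
      (∀ v : HeightOneSpectrum (𝓞 K), v ∉ S → Algebra.IsUnramifiedIn (𝓞 L) v.asIdeal) →
      ∀ (χ χ' : Additive (L ≃ₐ[K] L) →+ ZMod m), Φ L (χ + χ') = Φ L χ + Φ L χ')
    (hcompat : ∀ (L L' : IntermediateField K (AlgebraicClosure K)) [FiniteDimensional K L] [IsAbelianGalois K L]
      [FiniteDimensional K L'] [IsAbelianGalois K L'],
      (∀ v : HeightOneSpectrum (𝓞 K), v ∉ S → Algebra.IsUnramifiedIn (𝓞 L) v.asIdeal) →
      (∀ v : HeightOneSpectrum (𝓞 K), v ∉ S → Algebra.IsUnramifiedIn (𝓞 L') v.asIdeal) →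
      ∀ (χ : Additive (L ≃ₐ[K] L) →+ ZMod m) (χ' : Additive (L' ≃ₐ[K] L') →+ ZMod m),
      (∀ γ : absoluteGaloisGroup K,
        χ (Additive.ofMul (absRestrictNormalHom L γ)) = χ' (Additive.ofMul (absRestrictNormalHom L' γ))) →
      Φ L χ = Φ L' χ') :
    haveI : NeZero m := ⟨hm.ne'⟩
    ∃ x : ideleGroup K, ∀ (L : IntermediateField K (AlgebraicClosure K)) (_ : FiniteDimensional K L)
      (_ : IsAbelianGalois K L),
      (∀ v : HeightOneSpectrum (𝓞 K), v ∉ S → Algebra.IsUnramifiedIn (𝓞 L) v.asIdeal) →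
      ∀ χ : Additive (L ≃ₐ[K] L) →+ ZMod m,
      haveI : NumberField L := NumberField.of_module_finite K L
      zmodToQmodZ m (Φ L χ) =
        -classInvAll K L (baseCup (E := L) x
          (δ (intModShortComplex_shortExact (L ≃ₐ[K] L) m) 1 2 rfl
            ((H1IsoOfIsTrivial (Rep.trivial ℤ (L ≃ₐ[K] L) (ZMod m))).inv χ))) := by
  haveI : NeZero m := ⟨hm.ne'⟩
  obtain ⟨x, hx⟩ := exists_idele_forall_unramified_layer_character_eq hm S Φ hadd hcompat
  refine ⟨x, fun L hL hab hunr χ => ?_⟩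
  haveI := hL
  haveI := hab
  haveI : NumberField L := NumberField.of_module_finite K L
  rw [classInvAll_baseCup_bockstein_eq_artinIdeleMap L m χ x, neg_neg, hx L hL hab hunr χ]

end Surjectivity

end Literature.NumberTheory.GaloisRepresentations

end
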